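import Literature.MathematicalPhysics.QuantumFieldTheory.Balaban1983to89.B9Thm311FlippedBondForms

/-!
# `Balaban1983to89.B9Thm311FlippedBondNotPosDef` — T. Bałaban, *Propagators for lattice gauge theories in a background field*, Commun. Math. Phys. **99** (1985)
# 389–434 [Balaban1985BackgroundPropagators] Thm 3.11 p. 416 («Δ_a positive definite» UNDER (3.35)) read on def-Y's typed class: AT THE CONFIGURATION FLIPPED AT ONE
# BOND `Δ_a(U)` IS NOT POSITIVE DEFINITE, and AT A MEMBER WITH A BOND UNCOVERED BY THE TYPED CUBE CLASS THE N06 CERTIFICATE'S CLAUSE `hΔA` IS FALSE — the `¬`-side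
# modulo the existence of such a member (file 3∕3 of this seat's «Consequence 2» set; 1∕3 = `B9Thm311FlippedBondLetters`, 2∕3 = `B9Thm311FlippedBondForms`)

statement-level skeleton of published theorems with citation tags; proofs where landed; nothing here is a claim about the Yang–Mills mass gap

PDF held: `paper:balaban1985-cmp99-background-propagators` (journal page = PDF page + 388); pp. 390–396, 416 read by this seat (2026-08-27).

THE PRINT (verbatim).  p. 416, Thm 3.11: *«Let us assume that U satisfies (3.35). Then … the operators Δ′_a, G′, (Q′G′²Q′\*)⁻¹, Δ_a, G are positive definite.»*  p. 395,
(3.26): *«Δ_a = Δ + DRD\* + Q\*aQ»*.  p. 392, (3.10): *«⟨A, ΔA⟩ = ⟨A, D\*DA⟩ + ⟨A, Δ′A⟩, ⟨A, Δ′A⟩ = Σ_p η^d tr((D¹_UA)(p))²η⁻²(Re U(∂p) − 1) + …»*.  p. 396, (3.35):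
the class of backgrounds (cube gauges on the cubes of the class of p. 396).

WHY THIS SET OF THREE FILES (cell context).  NODE 06's certificate of record derives row 17 from the pin + ONE displayed clause `hΔA` = «for every `U` in the typed
class (3.35) (`(bg9Y …).Reg335 c35Y α₀ U`), `PosDefTr 1 (deltaAY x.toKIdx (parSymY _) (parBY _) (GpY _ (parSymY _)) U)`».  This seat's LOCATED-COVERAGE-1 (bus,
dag-lead g10 DESK WORD; director-ym №175 → def-Y WAKE R289) observed that def-Y's typed cube class `cubeClass396` (level window `{j, j+1}`, `n ≤ 10`) need not cover
a bond `b₀` crossing a big-block face of a one-block-thick level slab, and file 4 (`B9Eq335CoverageAtLettersY`) PROVED that at such an UNCOVERED bond the typed class is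
blind: `U(b₀) ↦ −U(b₀)` stays in the class.  These three files compute «Consequence 2» asked for by the desk and the referees (WATCH-ΔA ∕ A4): at the configuration
`U₁ = 1` flipped to `−1` at `b₀`, the single-bond test field `A = E·δ_{b₀}` has `⟨A, Δ_a(U₁)A⟩₁ ≤ (2 − d + 2b₁L^{−(d+3)})·c_f²·HS(E) < 0` (dimension `d+1 = 4`), so
`Δ_a(U₁)` is NOT positive definite although `U₁` is in the typed class — hence the clause body of `hΔA` is FALSE at any member with an uncovered bond.  WHETHER such a
member exists (a `TDomains` with the slab geometry inhabiting `MemberY`, `L ≥ 19`) is NOT decided here: the result is the `¬`-side MODULO that existence, and at the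
same time the settled negative that makes def-Y's class repair (r1)∕(r2)∕(r3) load-bearing.

WHAT IS PROVED HERE (sorry-free; 0 `def`; nothing of [B9] asserted).
* §6 ★★★ `trIP_deltaAY_single_le` (`⟨A, Δ_a(U)A⟩₁ ≤ (2 − d + 2b₁L^{−(d+1)}L⁻²)·c_f²·HS(E)` for `A = E·δ_{b₀}` at the configuration flipped at `b₀`, by g7's
  `trIP_deltaAY_parSymY_eq` + file 2∕3's three bounds), ★★★ **`not_posDefTr_deltaAY_flipped`** (`¬ PosDefTr 1 (deltaAY i (parSymY i) (parBY i) (GpY i (parSymY i)) U)`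
  whenever `2 + 2b₁L^{−(d+1)}L⁻² ≤ d` — at the record `d + 1 = 4`, i.e. for every band constant `b₁ ≤ L^{d+3}∕2`).
* §7 ★★★★ **`hΔA_body_false_of_uncovered`**: for `x : MemberY …`, `N` even and `≥ 1`, `2 + 2b₁L^{−(d+3)} ≤ d`, and a bond `b₀ = ⟨x₀, x₀+e_{μ₀}⟩` such that NO class cube
  of `cubeClass396 x.toKIdx` and none of `cubeClass396 x.snd` contains both endpoints, for every `a > 0`:
  `¬ (∀ α₀ > 0, (geo9Y x).M·α₀ ≤ a → ∀ U, (bg9Y (M_N(ℂ)) SU(N) x).Reg335 c35Y α₀ U → PosDefTr 1 (deltaAY x.toKIdx (parSymY _) (parBY _) (GpY _ (parSymY _)) U))` — the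
  witness is `U₁ = 1` flipped to `−1` at `b₀`: in the typed class by def-Y's `reg335_one` + file 4's `reg335_flipNegOne_of_uncovered` (both indices), not positive
  definite by §6.
MODEL ∕ DECLARED READINGS.  As files 1–2∕3; the member vocabulary `MemberY ∕ bg9Y ∕ geo9Y ∕ c35Y` of `B9PinMembersKLevelV1 ∕ B9PinGeometryKLevelV1`.  (M!) DISPLAYED AND
NOT DECIDED: the uncoveredness hypotheses `hunc`, `hunc'` — whether a member of `MemberY θ…` (for the θ of record) has such a bond is a property of its domain
sequences (`TDomains` admits a one-block-thick level-`j` slab whose big-block-face bonds are uncovered when `L ≥ 19`, LOCATED-COVERAGE-1; no member is constructed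
here).  Under def-Y's announced repair of the class (director-ym №175 → R289; options (r1) widen the level window, (r2) a printed plaquette clause, (r3) slab thickness)
`hunc` becomes unsatisfiable and §7 is the settled negative that justifies the repair.
HONEST SCOPE.  A `¬`-lemma MODULO member existence; NOT a refutation of the certificate (its binder quantifies over all members and carries the `M311 ≤ M` prefix);
count-neutral; NOT a node discharge; nothing continuum ∕ OS ∕ mass gap ∕ Clay.  Cell `pub-ymgap` (HUMAN RULING D-0062), Track A node N06 [B9], seat `pub-ymgap-dag-n06-j`
(bundle F5 rows 15–17; harness re-seat gen 11), 2026-08-27; dag-lead g10 INTENT-4 DEDUP.  NEW file importing file 2∕3; nothing landed is modified.  Net new unproved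
facts: 0.
-/

noncomputable section

namespace Literature.MathematicalPhysics.QuantumFieldTheory.Balaban1983to89.B9Thm311FlippedBondNotPosDef

open Literature.MathematicalPhysics.QuantumFieldTheory.Balaban1983to89
open B9Thm311ReadingCoords B9Thm311AdjointAtLetters B9Thm311DeltaPrimeSymm B9Thm311DeltaPrimePos B9Thm311AdjointPairs B9Thm311Curv2Symm
  B9Thm311ProjectionR B9Ineq349SiteAdjoint B9Ineq369CurvatureSmallAtLettersY B9Thm311PosOfPrincipalAtLettersY B9Eq335PlaquetteAtLettersY
  B9Eq335CoverageAtLettersY Node00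
open B6KLevelCensusIndexV1 B9BackgroundsKLevelV1 B6GlobalChartV1
open scoped Matrix
open B9Thm311FlippedBondLetters B9Thm311FlippedBondForms

/-! ## §6 `Δ_a(U)` IS NOT POSITIVE DEFINITE at the configuration flipped at one bond (`d ≥ 3`, i.e. dimension `d+1 ≥ 4`, and the (2.16) band not absurd) -/

section NotPosDef

open scoped Matrix.Norms.L2Operator

variable {d ℓ : ℕ} {hd : 1 ≤ d + 1} {hL : Odd (ℓ + 1) ∧ 1 < ℓ + 1} {b₀ b₁ : ℝ} {N : ℕ}
variable (i : KIdx d ℓ hd hL b₀ b₁)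

/-- the single-bond test field with the identity matrix is non-zero (`N ≥ 1`). [folklore] -/
private theorem single_one_ne_zero [Nonempty (Fin N)] (b₀ : FBondY i) : (Pi.single b₀ (1 : Matrix (Fin N) (Fin N) ℂ) : FBondY i → Matrix (Fin N) (Fin N) ℂ) ≠ 0 := by
  intro h
  have h1 := congrFun h b₀
  rw [Pi.single_eq_same, Pi.zero_apply] at h1
  obtain ⟨a⟩ := ‹Nonempty (Fin N)›
  have h2 := congrFun (congrFun h1 a) a
  simp at h2

variable {U : CfgY (Matrix (Fin N) (Fin N) ℂ) i} {μ₀ : Fin (PV d ℓ i.m i.K hd hL).d} {x₀ : Site (PV d ℓ i.m i.K hd hL) 0}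
  (hb₀ : U μ₀ x₀ = -1) (hoff : ∀ μ x, ¬ (μ = μ₀ ∧ x = x₀) → U μ x = 1)
include hb₀ hoff

/-- ★★★ **THE QUADRATIC FORM OF `Δ_a(U)` ON THE TEST FIELD**: at the configuration flipped at `b₀`, with `A = E·δ_{b₀}`,
`⟨A, Δ_a(U)A⟩₁ ≤ (2 − d + 2b₁L^{−(d+1)}L⁻²)·c_f²·HS(E)` — Wilson Hessian `≤ −d·c_f²HS(E)` (`d` frustrated plaquettes), gauge-fixing square `≤ 2c_f²HS(E)`,
averaging square `≤ 2b₁L^{−(d+3)}c_f²HS(E)`. [cite: Balaban1985BackgroundPropagators, (3.26) p.395, (3.10) p.392, Thm 3.11 p.416] -/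
theorem trIP_deltaAY_single_le [Nonempty (Fin N)] (hb₁ : 0 ≤ b₁) (E : Matrix (Fin N) (Fin N) ℂ) :
    trIP (fun _ => (1 : ℝ)) (Pi.single ⟨x₀, μ₀⟩ E) (deltaAY i (parSymY i) (parBY i) (GpY i (parSymY i)) U (Pi.single ⟨x₀, μ₀⟩ E)) ≤
      (2 - (d : ℝ) + 2 * b₁ * ((((((PV d ℓ i.m i.K hd hL).L : ℕ) : ℝ) ^ (PV d ℓ i.m i.K hd hL).d)⁻¹) * ((((ℓ + 1 : ℕ) : ℝ)) ^ 2)⁻¹)) *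
        (i.cf ^ 2 * ∑ a, ∑ b, ‖E a b‖ ^ 2) := by
  have hU := mem_of_flipped i hb₀ hoff
  rw [trIP_deltaAY_parSymY_eq i zpowers_neg_one_le_unitaryUnits hU]
  have h1 := trIP_hessY_single_le i hb₀ hoff E
  have h2 := trIP_gaugeFix_single_le i hb₀ hoff E
  have h3 := trIP_QY_single_le i hU hb₁ ⟨x₀, μ₀⟩ E
  nlinarith [h1, h2, h3]

/-- ★★★ **`Δ_a(U)` IS NOT POSITIVE DEFINITE at the configuration flipped at one bond** — for `d ≥ 2 + 2b₁L^{−(d+3)}` (at the record: dimension `d+1 = 4` and any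
band constant `b₁ ≤ L^{d+3}∕2`), at def-Y's letters `parSymY ∕ parBY ∕ GpY`. [cite: Balaban1985BackgroundPropagators, Thm 3.11 p.416 («Δ_a … positive definite» —
under (3.35)), (3.26) p.395] -/
theorem not_posDefTr_deltaAY_flipped [Nonempty (Fin N)] (hb₁ : 0 ≤ b₁)
    (hdim : (2 : ℝ) + 2 * b₁ * ((((((PV d ℓ i.m i.K hd hL).L : ℕ) : ℝ) ^ (PV d ℓ i.m i.K hd hL).d)⁻¹) * ((((ℓ + 1 : ℕ) : ℝ)) ^ 2)⁻¹) ≤ d) :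
    ¬ PosDefTr (fun _ => (1 : ℝ)) (deltaAY i (parSymY i) (parBY i) (GpY i (parSymY i)) U) := by
  intro hPD
  have hpos := hPD _ (single_one_ne_zero i ⟨x₀, μ₀⟩)
  have hle := trIP_deltaAY_single_le i hb₀ hoff hb₁ (1 : Matrix (Fin N) (Fin N) ℂ)
  have hnn : 0 ≤ i.cf ^ 2 * ∑ a, ∑ b, ‖(1 : Matrix (Fin N) (Fin N) ℂ) a b‖ ^ 2 := mul_nonneg (sq_nonneg _) (hs_nonneg _)
  nlinarith [mul_nonpos_of_nonpos_of_nonneg (by linarith : (2 - (d : ℝ) + 2 * b₁ *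
    ((((((PV d ℓ i.m i.K hd hL).L : ℕ) : ℝ) ^ (PV d ℓ i.m i.K hd hL).d)⁻¹) * ((((ℓ + 1 : ℕ) : ℝ)) ^ 2)⁻¹)) ≤ 0) hnn]

end NotPosDef

/-! ## §7 At a member with an UNCOVERED bond the certificate's clause `hΔA` is false (modulo the existence of such a member) -/

section Member

open scoped Matrix.Norms.L2Operator
open B9PinMembersKLevelV1 B9PinGeometryKLevelV1 B7Prop2SpecialUnitary

variable {d ℓ : ℕ} {hd : 1 ≤ d + 1} {hL : Odd (ℓ + 1) ∧ 1 < ℓ + 1} {b₀ b₁ : ℝ} {Mstar : ℕ} {N : ℕ}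

/-- ★★★ **ROW 17's CLAUSE `hΔA` IS UNSATISFIABLE AS TYPED AT A MEMBER WITH AN UNCOVERED BOND** (`N` even so that `−1 ∈ SU(N)`, `N ≥ 1`, dimension with
`d ≥ 2 + 2b₁L^{−(d+3)}`): if NO class cube of `cubeClass396 x.toKIdx` and none of `cubeClass396 x.snd` contains both endpoints of `b₀ = ⟨x₀, x₀+e_{μ₀}⟩`, then for
every `a > 0` the clause body `∀ α₀ > 0, M·α₀ ≤ a → ∀ U, (bg9Y …).Reg335 c35Y α₀ U → PosDefTr 1 (deltaAY x.toKIdx (parSymY _) (parBY _) (GpY _ (parSymY _)) U)` FAILS: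
the configuration `1` flipped at `b₀` to `−1` is in the typed class (def-Y's `reg335_one` + file 4's `reg335_flipNegOne_of_uncovered`) and its `Δ_a` is not positive
definite (§6).  WHETHER such a member exists is a property of the domain sequences `TDomains` (LOCATED-COVERAGE-1: a one-block-thick level-`j` slab, `L ≥ 19`) —
NOT decided here; this is the `¬`-side MODULO that existence. [cite: Balaban1985BackgroundPropagators, Thm 3.11 p.416, (3.35) p.396, (3.26) p.395] -/
theorem hΔA_body_false_of_uncovered [Nonempty (Fin N)] (hN : Even N) (x : MemberY d ℓ hd hL b₀ b₁ Mstar) (hb₁ : 0 ≤ b₁)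
    (hdim : (2 : ℝ) + 2 * b₁ * ((((((PV d ℓ x.m x.K hd hL).L : ℕ) : ℝ) ^ (PV d ℓ x.m x.K hd hL).d)⁻¹) * ((((ℓ + 1 : ℕ) : ℝ)) ^ 2)⁻¹) ≤ d)
    {μ₀ : Fin (PV d ℓ x.m x.K hd hL).d} {x₀ : Site (PV d ℓ x.m x.K hd hL) 0}
    (hunc : ∀ q ∈ cubeClass396 x.toKIdx, x₀ ∈ q.1 → x₀.shift μ₀ ∉ q.1)
    (hunc' : ∀ q ∈ cubeClass396 x.snd, x₀ ∈ q.1 → x₀.shift μ₀ ∉ q.1) {a : ℝ} (ha : 0 < a) :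
    ¬ (∀ α₀ : ℝ, 0 < α₀ → (geo9Y x).M * α₀ ≤ a →
        ∀ U : (bg9Y (Matrix (Fin N) (Fin N) ℂ) (specialUnitaryUnits (Fin N)) x).Cfg,
          (bg9Y (Matrix (Fin N) (Fin N) ℂ) (specialUnitaryUnits (Fin N)) x).Reg335 c35Y α₀ U →
            PosDefTr (fun _ => (1 : ℝ)) (deltaAY x.toKIdx (parSymY x.toKIdx) (parBY x.toKIdx) (GpY x.toKIdx (parSymY x.toKIdx)) U)) := by
  intro h
  have hM : 0 < (geo9Y x).M := by
    rw [geo9Y_M]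
    have h8 : 8 ≤ x.Mh := x.hM8
    positivity
  set α₀ : ℝ := a / (geo9Y x).M with hα₀
  have hα₀pos : 0 < α₀ := div_pos ha hM
  have hMa : (geo9Y x).M * α₀ ≤ a := by rw [hα₀, mul_div_cancel₀ _ hM.ne']
  -- the flipped configuration `U₁ = 1` except `U₁(b₀) = −1`
  set U₁ : CfgY (Matrix (Fin N) (Fin N) ℂ) x.toKIdx :=
    Function.update (1 : CfgY (Matrix (Fin N) (Fin N) ℂ) x.toKIdx) μ₀
      (Function.update ((1 : CfgY (Matrix (Fin N) (Fin N) ℂ) x.toKIdx) μ₀) x₀ ((-1) * (1 : CfgY (Matrix (Fin N) (Fin N) ℂ) x.toKIdx) μ₀ x₀)) with hU₁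
  have hone : (bg9K (Matrix (Fin N) (Fin N) ℂ) (specialUnitaryUnits (Fin N)) x.toKIdx).Reg335 c35Y α₀ (1 : CfgY (Matrix (Fin N) (Fin N) ℂ) x.toKIdx) :=
    reg335_one x.toKIdx c35Y_pos hα₀pos
  have hone' : (bg9K (Matrix (Fin N) (Fin N) ℂ) (specialUnitaryUnits (Fin N)) x.snd).Reg335 c35Y α₀ (1 : CfgY (Matrix (Fin N) (Fin N) ℂ) x.toKIdx) :=
    reg335_one x.snd c35Y_pos hα₀pos
  have hreg : (bg9Y (Matrix (Fin N) (Fin N) ℂ) (specialUnitaryUnits (Fin N)) x).Reg335 c35Y α₀ U₁ :=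
    ⟨reg335_flipNegOne_of_uncovered x.toKIdx hN hunc hone, reg335_flipNegOne_of_uncovered x.snd hN hunc' hone'⟩
  have hPD := h α₀ hα₀pos hMa U₁ hreg
  have hb₀ : U₁ μ₀ x₀ = -1 := by rw [hU₁, update_apply_self]; exact mul_one _
  have hoff : ∀ μ y, ¬ (μ = μ₀ ∧ y = x₀) → U₁ μ y = 1 := fun μ y hne => by rw [hU₁, update_apply_of_ne x.toKIdx _ μ₀ x₀ _ hne]; rfl
  exact not_posDefTr_deltaAY_flipped x.toKIdx hb₀ hoff hb₁ hdim hPD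

end Member

end Literature.MathematicalPhysics.QuantumFieldTheory.Balaban1983to89.B9Thm311FlippedBondNotPosDef
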